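import Summits.QuantumFields.YangMills.Theorems.UnitScaleTiltProp7CurvedMemberLocalGradient
import Summits.QuantumFields.YangMills.Theorems.UnitScaleTiltProp7KatoBootstrapMember
import Summits.QuantumFields.YangMills.Theorems.UnitScaleTiltProp7SectET3WCurrentProp4RowsT3
import Summits.QuantumFields.YangMills.Theorems.UnitScaleTiltProp7RieszTauFrobNormT3
import Literature.MathematicalPhysics.QuantumFieldTheory.Balaban1983to89.B9Eq344HessianRowDecomposition
import Literature.MathematicalPhysics.QuantumFieldTheory.Balaban1983to89.B9Eq3117CommutatorBound
import Literature.MathematicalPhysics.QuantumFieldTheory.Balaban1983to89.B9Eq344CovariantHessianRowTower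
import HarnessLib

/-!
# Route `UnitScaleTilt`, crux K1 «MinimiserStabilityRegPr» (stmt-QuantumFields-19200), EX row (5) `norm_G`, letter (Hess3) = `h3` (STOREY H) — brick (B4)+(B5)+(B6) of
# 19200 evidence #56 `LOCATE-Hess3-LIT-px13g16.md`: **THE LOCAL COVARIANT HESSIAN ROW AT THE T³ MEMBER — for `Δ^η_V u = ω`, every slice `w_μ = (D_V u)(·,μ)` has its η-gradient at
# the centre of a `tdist`-ball bounded by the local sup + η-½-Hölder data of `ω`, the local sups of `u` and `D_V u`, the plaquette∕current windows of `V` and the gauge flatness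
# `δ`, `Θ` of `V` in the ball, UP TO THE DISPLAYED Hessian sup `G₂`** (the route twin, in ✓`Prop7CurvedMemberLocalGradient.exists_curved_localGradient`'s local-axial-chart currency,
# of pub-balaban NE9's CLOSED engine `B9Eq344CovariantHessianRowTower.exists_hessRow_of_laplace_eq`) — width seat `ym3-torus-px13` (gen 16).

Cell `ym3-torus` (HUMAN RULING D-0037; rung R3 = SU(2) YM₃ on T³ — NOT d = 4, NOT infinite volume, NOT a mass gap, NOT Clay).  THEOREMS ONLY (0 `def`, 0 `sorry`, default heartbeats);
`--supports stmt-QuantumFields-19200 --as helper`; count-neutral.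

THE MATHEMATICS ([Balaban1985BackgroundPropagators] Thm 3.1 (3.44) p. 398, (3.117)–(3.120) p. 419, Thm 3.13 p. 426).  Differentiate `Δ^η_Vu = ω` covariantly along `e_μ`: the slice
`w_μ := (D_Vu)(·,μ)` solves the SCALAR massive equation `Δ^η_V w_μ + (−Comm_μ(u)) = D*_V A_ω`, `A_ω(y,κ) := −δ_{κμ}·R(V(y,μ))ω(y+e_μ)` (so `(D_Vω)(·,μ) = D*_VA_ω` EXACTLY), `Comm_μ(u)` = the
two-plaquette commutator sum `[Δ^η_V, ∇_μ]u` — this is lit ✓`B9Eq344HessianRowDecomposition.laplace_add_one_hessSlice_eq`, GENERIC in the torus and the transporters, read at the member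
(`R := adBg F K V`, `S := adBgInv F K V`, `c := η⁻¹`; ✓`covLapSite_eq` is `rfl`).  The equation is EXACTLY the hypothesis shape `h` of ✓`exists_curved_localGradient` (the curved local
η-gradient row on divergence-form HÖLDER data plus an `L^∞` remainder — print's (3.44) at the member, landed px12∕px19∕w5), with `u := w_μ`, `f := A_ω`, `q := −Comm_μ(u)`:
its data rows are `‖A_ω‖ ≤ N_ω` (transport is an isometry ✓`norm_adBg_eq`), `[A_ω]_{½} ≤ 2√2·Θ·N_ω + H_ω` (two bonds ✓`norm_adBg_sub_adBg_le` + the ½-Hölder row of `ω` at the shifted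
points, `d(y+e_μ, y′+e_μ) = d(y, y′)` ✓`tdist_shift_shift`), `‖Comm_μ(u)‖ ≤ √2·((2j + 24α²η)·M_u + 12α·M_w)` (lit ✓`B9Eq3117CommutatorBound.norm_commutator_sum_le`, GENERIC, at
`U := bgOfCfg F K V` ✓`bgOfCfg_mem_U1`, `φ := frobEquiv` ✓`norm_frobEquiv_le`∕✓`norm_frobEquiv_symm_le`, plaquette window `‖V(∂p) − 1‖ ≤ αη²`, current window `‖J_μ‖ ≤ j` — print's
(3.35)–(3.36)), and `‖w_μ‖ ≤ M_w`; its conclusion is the η-gradient of `w_μ`, i.e. THE HESSIAN ROW of `u`, with the Hessian sup `G₂` on the `(12ℓ+3)`-ball DISPLAYED exactly as (G1-3a)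
displays `G` (absorbed GLOBALLY in the sequel, ✓`gradient_absorption`'s pattern).  For the third word of `𝔊` take `u := λ₁ = G′ᴾR_SD*G₁x`, `ω := ω₁ = R_SD*G₁x` (`Δ^ηλ₁ = ω₁`
✓`covLapSite_GprimeP_RS`): `M_u` ⟸ (c1), `M_w` ⟸ (c2), `N_ω` ⟸ (Div1)∘`R_S`, `H_ω` = brick (B2) of the LOCATE — NO gradient of `ω₁` is ever asked (the Calderón–Zygmund trap of HESS-T1's `G_φ`).

WHAT IS PROVED (ns `Summit.QuantumFields.YangMills.Theorems.Prop7CurvedMemberLocalHessian`; member `F n K`, weight `c₀ > 0`, background `V` IN A GIVEN GAUGE, generic `u ω`).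
* §1 `adBg_apply_eq_adTransportW`, `adBgInv_apply_eq_adTransportW_inv`, `adBgInv_eq_adTransportW_inv` — the route's transporters ARE lit's `adTransportW frobEquiv (bgOfCfg F K V)^{±1}` (pointwise∕as
  a family; the `adBg` family identity is ✓`Prop7BlockPoincareKerQprime.adBg_eq_adTransportW`, not re-stated).
* §2 ★ `slice_equation` — `covLapSite F n K c₀ V w_μ + (−Comm_μ(u)) = DstarL2 F n K c₀ V A_ω` for `covLapSite F n K c₀ V u = ω` (lit's identity at the member, `w_μ`, `A_ω`, `Comm_μ` spelled on
  the route carriers).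
* §3 ★ `norm_Aω_le`, ★ `norm_Aω_sub_le` (the value and ½-Hölder rows of `A_ω`), ★★ `norm_comm_le` (the commutator row from the plaquette∕current windows and the local sups of `u`, `D_Vu`).
* §4 ★★★ **`exists_curved_localHessian`** — `∃ CH ≥ 0` (the constant of ✓`exists_curved_localGradient`) such that for EVERY member, weight, background `V`, `u ω` with `Δ^η_Vu = ω`, centre `x`,
  direction `μ` and letters `N_ω H_ω M_u M_w G₂ δ Θ α j`: local rows (radii `4ℓ+2`, `4ℓ+1`, `4ℓ`, `12ℓ+3` as displayed) ⟹
  `∀ ν, ℓ·‖(D_Vu)(x+e_ν, μ) − (D_Vu)(x, μ)‖ ≤ CH·(M_w + (H_A + 2√2((ℓΘ)M_w + (ℓδ)(3√10·G₂))) + (6√2(ℓδ)(N_ω + G₂ + 2√2(ℓδ)M_w) + M_w + M_C))`,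
  `H_A = 2√2·Θ·N_ω + H_ω`, `M_C = √2·((2j + 24α²η)·M_u + 12α·M_w)`.
HYP-SAT (★★OWNER RULING №42).  Every hypothesis is the member equation or a real inequality between displayed terms on finite balls: at any fixed data the sups∕moduli are finite maxima
(`H_ω` with the ½-power `≥ ℓ^{−1∕2}` off the diagonal), so all rows are inhabited; with K-FREE letters on the T³ member exactly as for (G1-3a): `ℓδ`, `ℓΘ = O(ε₀)` in the cube axial gauge
(✓`Prop7CubeCutoffFlatness.hUV_cubeGauge`, ✓`AxialGaugeMemberModulus.dist1_axialT_translate_le_of_clauses`), `αη²` plaquette window and `j`-current from `RegPr` (✓`norm_plaqHolU_bgOfCfg_sub_one_lt`,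
✓`norm_J_one_le_of_regPr`, gauge invariant), `N_ω M_u M_w` from (Div1)(c1)(c2).  The conclusion is a non-vacuous real inequality; no `Prop`-valued hypothesis restates it.
HONEST SCOPE.  Composition of landed theorems (lit's generic identity + commutator bound; the route's (3.44) local knit); `G₂` and the ½-Hölder row of `ω` are LETTERS; nothing of (B2) (the
Hölder row of `ω₁`), (B7) (the global absorption), `h3`, `norm_G`, the EX display, EX `stub_existenceMinimalOrbit`, `MinimiserStabilityRegPr` (19200) or R3 is proved here; the Yang–Mills
mass gap is NOT proved.

References: T. Bałaban, CMP **99** (1985) 389–434 [Balaban1985BackgroundPropagators] (Thm 3.1 (3.43)–(3.44) p.398, (3.3)∕(3.8) pp.391–392, (3.23) p.394, (3.35)–(3.36) p.396,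
(3.117)–(3.120) p.419, Thm 3.13 p.426); CMP **96** (1984) 223–250 [Balaban1984PropagatorsII] ((1.9) p.226); CMP **102** (1985) 277–309 [Balaban1985Variational] ((117) p.295).
-/

set_option autoImplicit false

noncomputable section

open scoped InnerProductSpace ComplexConjugate BigOperators Matrix.Norms.L2Operator

namespace Summit.QuantumFields.YangMills.Theorems.Prop7CurvedMemberLocalHessian

open Literature.MathematicalPhysics.QuantumFieldTheory.Balaban1983to89
open Literature.MathematicalPhysics.QuantumFieldTheory.Balaban1983to89.T3ContinuumYM3Torus
open B4Sect5Torus (TSite tdist tdist_triangle tdist_symm tdist_nonneg)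
open B9SectCLatticeCarrier (Bond shift unshift)
open B9Eq33CovDerivVector (covDeriv shiftEquiv)
open B9Eq39Adjoint (plaqU J)
open B9Eq311L2Pairing (WL2)
open B9Eq310HessianOperator (adTransportW adTransportW_apply)
open B11Eq103H1Complex (SiteL2K BondL2K covDerivL2K covDivL2K covLaplaceSiteK equiv_covDerivL2K)
open B7Prop1Explicit (U1)
open B9Eq344HessianRowDecomposition (laplace_add_one_hessSlice_eq)
open B9Eq3117CommutatorBound (norm_commutator_sum_le)
open B9Eq344CovariantHessianRowTower (tdist_shift_shift)
open T3SectALandauChart (eta eta_pos)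
open Summit.QuantumFields.YangMills.Theorems.Prop7SectET3Transport (periodsT3 bgOfCfg)
open Summit.QuantumFields.YangMills.Theorems.Prop7SectET3HilbertLetters (W₂ frobEquiv adW adBg adBgInv frobEquiv_adW DL2 DstarL2 covLapSite covLapSite_eq)
open Summit.QuantumFields.YangMills.Theorems.Prop7RieszTauFrobNorm (norm_frobEquiv_le norm_frobEquiv_symm_le)
open Summit.QuantumFields.YangMills.Theorems.Prop7KatoBootstrapMember (norm_adBg_eq norm_adBgInv_eq adBgInv_adBg)
open Summit.QuantumFields.YangMills.Theorems.Prop7TwoBackgroundGradientComparison (one_le_periodsT3 norm_adBg_sub_adBg_le)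
open Summit.QuantumFields.YangMills.Theorems.Prop7SectET3WCurrentProp4Rows (bgOfCfg_mem_U1)
open Summit.QuantumFields.YangMills.Theorems.Prop7CurvedMemberLocalGradient (exists_curved_localGradient)

variable (F : T3Family) (n K : ℕ) (c₀ : ℝ) [Fact (0 < c₀)]

/-! ## §1 The route's transporters are lit's `Ad`-transporters read through `frobEquiv` -/

omit [Fact (0 < c₀)] in
/-- `adBg F K V b w = adTransportW frobEquiv (bgOfCfg F K V) b w` (both are `frobEquiv⁻¹(U·frobEquiv w·U⁻¹)`; the family identity is ✓`Prop7BlockPoincareKerQprime.adBg_eq_adTransportW`).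
[cite: Balaban1985BackgroundPropagators, (3.3) p.391] -/
theorem adBg_apply_eq_adTransportW (V : GaugeField (F.P K) 0 (Matrix.specialUnitaryGroup (Fin 2) ℂ)) (b : Bond 3 (periodsT3 F K)) (w : W₂) :
    adBg F K V b w = adTransportW frobEquiv (bgOfCfg F K V) b w := by
  apply frobEquiv.injective
  rw [adBg, frobEquiv_adW, adTransportW_apply, LinearEquiv.apply_symm_apply]

omit [Fact (0 < c₀)] in
/-- `adBgInv F K V b w = adTransportW frobEquiv (fun b ↦ (bgOfCfg F K V b)⁻¹) b w` (the inverse transporter of (3.8)). [cite: Balaban1985BackgroundPropagators, (3.5) p.391, (3.8) p.392] -/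
theorem adBgInv_apply_eq_adTransportW_inv (V : GaugeField (F.P K) 0 (Matrix.specialUnitaryGroup (Fin 2) ℂ)) (b : Bond 3 (periodsT3 F K)) (w : W₂) :
    adBgInv F K V b w = adTransportW frobEquiv (fun b => (bgOfCfg F K V b)⁻¹) b w := by
  apply frobEquiv.injective
  rw [adBgInv, frobEquiv_adW, adTransportW_apply, LinearEquiv.apply_symm_apply, inv_inv]

omit [Fact (0 < c₀)] in
/-- The inverse-transporter family is lit's `adTransportW frobEquiv (U⁻¹)`. [cite: Balaban1985BackgroundPropagators, (3.8) p.392] -/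
theorem adBgInv_eq_adTransportW_inv (V : GaugeField (F.P K) 0 (Matrix.specialUnitaryGroup (Fin 2) ℂ)) :
    adBgInv F K V = adTransportW frobEquiv (fun b => (bgOfCfg F K V b)⁻¹) := by
  funext b
  exact LinearMap.ext fun w => adBgInv_apply_eq_adTransportW_inv F K V b w

/-! ## §2 The slice equation at the member -/

/-- ★ **THE SLICE EQUATION**: if `Δ^η_V u = ω` then, for every direction `μ`, the slice `w_μ := (D_Vu)(·,μ)` (read as a site vector) satisfies
`Δ^η_V w_μ + (−Comm_μ(u)) = D*_V A_ω` with `A_ω(y,κ) = −δ_{κμ}·R(V(y,μ))ω(y+e_μ)` and `Comm_μ(u)` the two-plaquette commutator sum — lit ✓`laplace_add_one_hessSlice_eq` (generic torus,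
generic transporters) at `R := adBg F K V`, `S := adBgInv F K V`, `c := η⁻¹` (✓`covLapSite_eq`, ✓`adBgInv_adBg`), with the `+ w_μ` of `(Δ + 1)w_μ` cancelled.  This is EXACTLY the hypothesis
shape `h` of ✓`exists_curved_localGradient` with `u := w_μ`, `q := −Comm_μ(u)`, `f := A_ω`. [cite: Balaban1985BackgroundPropagators, (3.23) p.394, (3.117) p.419, Thm 3.1 (3.44) p.398] -/
theorem slice_equation (V : GaugeField (F.P K) 0 (Matrix.specialUnitaryGroup (Fin 2) ℂ)) (u ω : SiteL2K ℂ 3 (periodsT3 F K) c₀ W₂)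
    (hEq : covLapSite F n K c₀ V u = ω) (μ : Fin 3) :
    covLapSite F n K c₀ V
        ((WL2.equiv ℂ (fun _ : TSite 3 (periodsT3 F K) => c₀) W₂).symm fun y => WL2.equiv ℂ (fun _ : Bond 3 (periodsT3 F K) => c₀) W₂ (DL2 F n K c₀ V u) (y, μ)) +
      (-((WL2.equiv ℂ (fun _ : TSite 3 (periodsT3 F K) => c₀) W₂).symm fun x =>
          (((eta F n K : ℝ) : ℂ))⁻¹ • ((((eta F n K : ℝ) : ℂ))⁻¹ • ((((eta F n K : ℝ) : ℂ))⁻¹ • ∑ κ,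
            ((adBg F K V (x, μ) (adBg F K V (shift μ x, κ) (WL2.equiv ℂ (fun _ : TSite 3 (periodsT3 F K) => c₀) W₂ u (shift κ (shift μ x)))) -
                adBg F K V (x, κ) (adBg F K V (shift κ x, μ) (WL2.equiv ℂ (fun _ : TSite 3 (periodsT3 F K) => c₀) W₂ u (shift μ (shift κ x))))) +
             (adBg F K V (x, μ) (adBgInv F K V (unshift κ (shift μ x), κ) (WL2.equiv ℂ (fun _ : TSite 3 (periodsT3 F K) => c₀) W₂ u (unshift κ (shift μ x)))) -
                adBgInv F K V (unshift κ x, κ) (adBg F K V (unshift κ x, μ) (WL2.equiv ℂ (fun _ : TSite 3 (periodsT3 F K) => c₀) W₂ u (shift μ (unshift κ x)))))))))) =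
      DstarL2 F n K c₀ V ((WL2.equiv ℂ (fun _ : Bond 3 (periodsT3 F K) => c₀) W₂).symm fun b =>
        if b.2 = μ then -(adBg F K V (b.1, μ) (WL2.equiv ℂ (fun _ : TSite 3 (periodsT3 F K) => c₀) W₂ ω (shift μ b.1))) else 0) := by
  have hSR : ∀ (b : Bond 3 (periodsT3 F K)) (w : W₂), adBgInv F K V b (adBg F K V b w) = w := fun b w => adBgInv_adBg F K V b w
  have hEq' : covLaplaceSiteK (c₀ := c₀) ((((eta F n K : ℝ) : ℂ))⁻¹) (adBg F K V) (adBgInv F K V) u = ω := by rw [← covLapSite_eq]; exact hEq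
  have h := laplace_add_one_hessSlice_eq (c₀ := c₀) ((((eta F n K : ℝ) : ℂ))⁻¹) (adBg F K V) (adBgInv F K V) hSR u ω hEq' μ
  rw [LinearMap.add_apply, LinearMap.smul_apply, LinearMap.id_apply, one_smul, ← covLapSite_eq] at h
  -- `h : Δ w + w = D*A + (Comm + w)`; split the symm of the sum and cancel `w`
  have hsplit : ((WL2.equiv ℂ (fun _ : TSite 3 (periodsT3 F K) => c₀) W₂).symm fun x =>
          (((eta F n K : ℝ) : ℂ))⁻¹ • ((((eta F n K : ℝ) : ℂ))⁻¹ • ((((eta F n K : ℝ) : ℂ))⁻¹ • ∑ κ,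
            ((adBg F K V (x, μ) (adBg F K V (shift μ x, κ) (WL2.equiv ℂ (fun _ : TSite 3 (periodsT3 F K) => c₀) W₂ u (shift κ (shift μ x)))) -
                adBg F K V (x, κ) (adBg F K V (shift κ x, μ) (WL2.equiv ℂ (fun _ : TSite 3 (periodsT3 F K) => c₀) W₂ u (shift μ (shift κ x))))) +
             (adBg F K V (x, μ) (adBgInv F K V (unshift κ (shift μ x), κ) (WL2.equiv ℂ (fun _ : TSite 3 (periodsT3 F K) => c₀) W₂ u (unshift κ (shift μ x)))) -
                adBgInv F K V (unshift κ x, κ) (adBg F K V (unshift κ x, μ) (WL2.equiv ℂ (fun _ : TSite 3 (periodsT3 F K) => c₀) W₂ u (shift μ (unshift κ x)))))))) +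
          WL2.equiv ℂ (fun _ : Bond 3 (periodsT3 F K) => c₀) W₂ (covDerivL2K ℂ c₀ ((((eta F n K : ℝ) : ℂ))⁻¹) (adBg F K V) u) (x, μ))
      = ((WL2.equiv ℂ (fun _ : TSite 3 (periodsT3 F K) => c₀) W₂).symm fun x =>
          (((eta F n K : ℝ) : ℂ))⁻¹ • ((((eta F n K : ℝ) : ℂ))⁻¹ • ((((eta F n K : ℝ) : ℂ))⁻¹ • ∑ κ,
            ((adBg F K V (x, μ) (adBg F K V (shift μ x, κ) (WL2.equiv ℂ (fun _ : TSite 3 (periodsT3 F K) => c₀) W₂ u (shift κ (shift μ x)))) -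
                adBg F K V (x, κ) (adBg F K V (shift κ x, μ) (WL2.equiv ℂ (fun _ : TSite 3 (periodsT3 F K) => c₀) W₂ u (shift μ (shift κ x))))) +
             (adBg F K V (x, μ) (adBgInv F K V (unshift κ (shift μ x), κ) (WL2.equiv ℂ (fun _ : TSite 3 (periodsT3 F K) => c₀) W₂ u (unshift κ (shift μ x)))) -
                adBgInv F K V (unshift κ x, κ) (adBg F K V (unshift κ x, μ) (WL2.equiv ℂ (fun _ : TSite 3 (periodsT3 F K) => c₀) W₂ u (shift μ (unshift κ x))))))))) +
        ((WL2.equiv ℂ (fun _ : TSite 3 (periodsT3 F K) => c₀) W₂).symm fun y =>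
          WL2.equiv ℂ (fun _ : Bond 3 (periodsT3 F K) => c₀) W₂ (DL2 F n K c₀ V u) (y, μ)) := by
    rfl
  rw [hsplit] at h
  -- `Δ w + w = D*A + (C + w)` ⟹ `Δ w + (−C) = D*A`
  have key : ∀ (a w d c : SiteL2K ℂ 3 (periodsT3 F K) c₀ W₂), a + w = d + (c + w) → a + -c = d := by
    intro a w d c hk
    have hk' : a = d + c := by rw [eq_sub_of_add_eq hk]; abel
    rw [hk']; abel
  exact key _ _ _ _ h

/-! ## §3 The rows of `A_ω` and of the commutator -/

omit [Fact (0 < c₀)] in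
/-- ★ **THE VALUE ROW OF `A_ω`**: `‖A_ω(b)‖ ≤ ‖ω(b₋ + e_μ)‖` (`Ad` of an `SU(2)` bond variable is a Frobenius isometry ✓`norm_adBg_eq`). [cite: Balaban1985BackgroundPropagators, (3.3) p.391, (3.39) p.397] -/
theorem norm_Aω_le (V : GaugeField (F.P K) 0 (Matrix.specialUnitaryGroup (Fin 2) ℂ)) (ω' : TSite 3 (periodsT3 F K) → W₂) (μ : Fin 3) (b : Bond 3 (periodsT3 F K)) :
    ‖(if b.2 = μ then -(adBg F K V (b.1, μ) (ω' (shift μ b.1))) else 0 : W₂)‖ ≤ ‖ω' (shift μ b.1)‖ := by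
  split_ifs with hb
  · rw [norm_neg, norm_adBg_eq]
  · rw [norm_zero]; exact norm_nonneg _

omit [Fact (0 < c₀)] in
/-- ★ **THE TWO-POINT ROW OF `A_ω`**: `‖A_ω(y′,κ) − A_ω(y,κ)‖ ≤ 2√2·‖V(y′,μ) − V(y,μ)‖·‖ω(y′+e_μ)‖ + ‖ω(y′+e_μ) − ω(y+e_μ)‖` (two bonds ✓`norm_adBg_sub_adBg_le`, isometry ✓`norm_adBg_eq`).
[cite: Balaban1985BackgroundPropagators, (3.40) p.397, Thm 3.1 (3.43) p.398] -/
theorem norm_Aω_sub_le (V : GaugeField (F.P K) 0 (Matrix.specialUnitaryGroup (Fin 2) ℂ)) (ω' : TSite 3 (periodsT3 F K) → W₂) (μ κ : Fin 3) (y y' : TSite 3 (periodsT3 F K)) :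
    ‖(if ((y', κ) : Bond 3 (periodsT3 F K)).2 = μ then -(adBg F K V (((y', κ) : Bond 3 (periodsT3 F K)).1, μ) (ω' (shift μ ((y', κ) : Bond 3 (periodsT3 F K)).1))) else 0 : W₂) -
        (if ((y, κ) : Bond 3 (periodsT3 F K)).2 = μ then -(adBg F K V (((y, κ) : Bond 3 (periodsT3 F K)).1, μ) (ω' (shift μ ((y, κ) : Bond 3 (periodsT3 F K)).1))) else 0 : W₂)‖ ≤
      2 * Real.sqrt 2 * ‖((bgOfCfg F K V (y', μ) : (Matrix (Fin 2) (Fin 2) ℂ)ˣ) : Matrix (Fin 2) (Fin 2) ℂ) - ((bgOfCfg F K V (y, μ) : (Matrix (Fin 2) (Fin 2) ℂ)ˣ) : Matrix (Fin 2) (Fin 2) ℂ)‖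
          * ‖ω' (shift μ y')‖ + ‖ω' (shift μ y') - ω' (shift μ y)‖ := by
  by_cases hκ : κ = μ
  · simp only [hκ, if_true]
    have h1 := norm_adBg_sub_adBg_le F K V (y', μ) (y, μ) (ω' (shift μ y'))
    have h2 : ‖adBg F K V (y, μ) (ω' (shift μ y')) - adBg F K V (y, μ) (ω' (shift μ y))‖ = ‖ω' (shift μ y') - ω' (shift μ y)‖ := by
      rw [← map_sub, norm_adBg_eq]
    calc ‖-(adBg F K V (y', μ) (ω' (shift μ y'))) - -(adBg F K V (y, μ) (ω' (shift μ y)))‖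
        = ‖adBg F K V (y', μ) (ω' (shift μ y')) - adBg F K V (y, μ) (ω' (shift μ y))‖ := by
          rw [show -(adBg F K V (y', μ) (ω' (shift μ y'))) - -(adBg F K V (y, μ) (ω' (shift μ y)))
              = -(adBg F K V (y', μ) (ω' (shift μ y')) - adBg F K V (y, μ) (ω' (shift μ y))) by abel, norm_neg]
      _ = ‖(adBg F K V (y', μ) (ω' (shift μ y')) - adBg F K V (y, μ) (ω' (shift μ y'))) + (adBg F K V (y, μ) (ω' (shift μ y')) - adBg F K V (y, μ) (ω' (shift μ y)))‖ := by
          congr 1; abel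
      _ ≤ ‖adBg F K V (y', μ) (ω' (shift μ y')) - adBg F K V (y, μ) (ω' (shift μ y'))‖ + ‖adBg F K V (y, μ) (ω' (shift μ y')) - adBg F K V (y, μ) (ω' (shift μ y))‖ := norm_add_le _ _
      _ ≤ _ := by rw [h2]; exact add_le_add h1 le_rfl
  · simp only [hκ, if_false, sub_zero, norm_zero]
    positivity

/-- ★★ **THE COMMUTATOR ROW**: under the plaquette window `‖V(∂p) − 1‖ ≤ αη²` (all plaquettes) and with the current `J_μ(x′)` of `V`, the two-plaquette sum `Comm_μ(u)(x′)` obeys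
`‖Comm_μ(u)(x′)‖ ≤ √2·((2‖J_μ(x′)‖ + 8·3·α²η)·‖u(x′+e_μ)‖ + 2α·Σ_κ(‖(D_Vu)(x′+e_μ,κ)‖ + ‖(D_Vu)(x′+e_μ−e_κ,κ)‖))` — lit ✓`norm_commutator_sum_le` (generic) at `U := bgOfCfg F K V`
(✓`bgOfCfg_mem_U1`), `φ := frobEquiv` (`M_φ = 1` ✓`norm_frobEquiv_le`, `M_φ′ = √2` ✓`norm_frobEquiv_symm_le`), transporters contracting (✓`norm_adBg_eq`∕✓`norm_adBgInv_eq`), read back through §1.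
[cite: Balaban1985BackgroundPropagators, (3.11) p.392, (3.35)–(3.36) p.396, (3.117)–(3.120) p.419] -/
theorem norm_comm_le (V : GaugeField (F.P K) 0 (Matrix.specialUnitaryGroup (Fin 2) ℂ)) {α : ℝ} (hα : 0 ≤ α)
    (hpl : ∀ (κ ν : Fin 3) (x : TSite 3 (periodsT3 F K)),
      ‖((plaqU (fun μ => shiftEquiv (Pd := periodsT3 F K) μ) (fun μ y => bgOfCfg F K V (y, μ)) κ ν x : (Matrix (Fin 2) (Fin 2) ℂ)ˣ) : Matrix (Fin 2) (Fin 2) ℂ) - 1‖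
        ≤ α * eta F n K ^ 2)
    (u : SiteL2K ℂ 3 (periodsT3 F K) c₀ W₂) (μ : Fin 3) (x' : TSite 3 (periodsT3 F K)) :
    ‖(((eta F n K : ℝ) : ℂ))⁻¹ • ((((eta F n K : ℝ) : ℂ))⁻¹ • ((((eta F n K : ℝ) : ℂ))⁻¹ • ∑ κ,
        ((adBg F K V (x', μ) (adBg F K V (shift μ x', κ) (WL2.equiv ℂ (fun _ : TSite 3 (periodsT3 F K) => c₀) W₂ u (shift κ (shift μ x')))) -
            adBg F K V (x', κ) (adBg F K V (shift κ x', μ) (WL2.equiv ℂ (fun _ : TSite 3 (periodsT3 F K) => c₀) W₂ u (shift μ (shift κ x'))))) +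
         (adBg F K V (x', μ) (adBgInv F K V (unshift κ (shift μ x'), κ) (WL2.equiv ℂ (fun _ : TSite 3 (periodsT3 F K) => c₀) W₂ u (unshift κ (shift μ x')))) -
            adBgInv F K V (unshift κ x', κ) (adBg F K V (unshift κ x', μ) (WL2.equiv ℂ (fun _ : TSite 3 (periodsT3 F K) => c₀) W₂ u (shift μ (unshift κ x'))))))))‖ ≤
      1 * Real.sqrt 2 * ((2 * ‖J (fun μ => shiftEquiv (Pd := periodsT3 F K) μ) (fun μ y => bgOfCfg F K V (y, μ)) (eta F n K) μ x'‖ + 8 * (3 : ℕ) * α ^ 2 * eta F n K) *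
          ‖WL2.equiv ℂ (fun _ : TSite 3 (periodsT3 F K) => c₀) W₂ u (shift μ x')‖ +
        2 * α * ∑ κ, (‖WL2.equiv ℂ (fun _ : Bond 3 (periodsT3 F K) => c₀) W₂ (DL2 F n K c₀ V u) (shift μ x', κ)‖ +
          ‖WL2.equiv ℂ (fun _ : Bond 3 (periodsT3 F K) => c₀) W₂ (DL2 F n K c₀ V u) (unshift κ (shift μ x'), κ)‖)) := by
  have hη : 0 < eta F n K := eta_pos F n K
  have hφ : ∀ w : W₂, ‖frobEquiv w‖ ≤ 1 * ‖w‖ := fun w => by rw [one_mul]; exact norm_frobEquiv_le w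
  have hφ' : ∀ X : Matrix (Fin 2) (Fin 2) ℂ, ‖(frobEquiv.symm X : W₂)‖ ≤ Real.sqrt 2 * ‖X‖ := norm_frobEquiv_symm_le
  have hRn : ∀ (b : Bond 3 (periodsT3 F K)) (w : W₂), ‖adTransportW frobEquiv (bgOfCfg F K V) b w‖ ≤ ‖w‖ := fun b w => by
    rw [← adBg_apply_eq_adTransportW, norm_adBg_eq]
  have hSn : ∀ (b : Bond 3 (periodsT3 F K)) (w : W₂), ‖adTransportW frobEquiv (fun b => (bgOfCfg F K V b)⁻¹) b w‖ ≤ ‖w‖ := fun b w => by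
    rw [← adBgInv_apply_eq_adTransportW_inv, norm_adBgInv_eq]
  have h := norm_commutator_sum_le frobEquiv hφ hφ' zero_le_one (Real.sqrt_nonneg 2) (bgOfCfg F K V) (bgOfCfg_mem_U1 F K V) hη hα hpl hRn hSn
    (WL2.equiv ℂ (fun _ : TSite 3 (periodsT3 F K) => c₀) W₂ u) μ x'
  simp only [← adBg_apply_eq_adTransportW, ← adBgInv_apply_eq_adTransportW_inv] at h
  have hfam : adTransportW frobEquiv (bgOfCfg F K V) = adBg F K V := by
    funext b'
    exact LinearMap.ext fun w => (adBg_apply_eq_adTransportW F K V b' w).symm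
  have hD : ∀ b : Bond 3 (periodsT3 F K), covDeriv ((((eta F n K : ℝ) : ℂ))⁻¹) (adTransportW frobEquiv (bgOfCfg F K V)) (WL2.equiv ℂ (fun _ : TSite 3 (periodsT3 F K) => c₀) W₂ u) b =
      WL2.equiv ℂ (fun _ : Bond 3 (periodsT3 F K) => c₀) W₂ (DL2 F n K c₀ V u) b := fun b => by
    rw [hfam]; rfl
  simp only [hD] at h
  exact h

/-! ## §4 ★★★ The local covariant Hessian row -/

/-- ★★★ **THE LOCAL COVARIANT HESSIAN ROW AT THE T³ MEMBER (route twin of lit `exists_hessRow_of_laplace_eq`, local-axial-chart currency).**  There is ONE `CH ≥ 0` (the constant of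
✓`exists_curved_localGradient`) such that for every member `(F, n, K)`, weight `c₀`, background `V`, site fields `u ω` with `Δ^η_V u = ω`, centre `x`, slice direction `μ` and letters: the local
sup `N_ω` and η-½-Hölder modulus `H_ω` of `ω`, the local sups `M_u` of `u` and `M_w` of `D_Vu`, the DISPLAYED Hessian sup `G₂` on the `(12ℓ+3)`-ball, the plaquette window `αη²`, the local current
bound `j`, and the gauge flatness `δ`, `Θ` of `V` ⟹ for every `ν`,
`ℓ·‖(D_Vu)(x+e_ν, μ) − (D_Vu)(x, μ)‖ ≤ CH·(M_w + (H_A + 2√2((ℓΘ)M_w + (ℓδ)(3√10·G₂))) + (6√2(ℓδ)(N_ω + G₂ + 2√2(ℓδ)M_w) + M_w + M_C))`, `H_A = 2√2ΘN_ω + H_ω`,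
`M_C = √2((2j + 24α²η)M_u + 12αM_w)` — §2 fed to ✓`exists_curved_localGradient` with `u := w_μ`, `f := A_ω`, `q := −Comm_μ(u)` and §3's rows.
[cite: Balaban1985BackgroundPropagators, Thm 3.1 (3.43)–(3.44) p.398, (3.117)–(3.120) p.419, Thm 3.13 p.426; Balaban1984PropagatorsII, (1.9) p.226] -/
theorem exists_curved_localHessian : ∃ CH : ℝ, 0 ≤ CH ∧
    ∀ (F : T3Family) (n K : ℕ) (c₀ : ℝ) [Fact (0 < c₀)] (V : GaugeField (F.P K) 0 (Matrix.specialUnitaryGroup (Fin 2) ℂ))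
      (u ω : SiteL2K ℂ 3 (periodsT3 F K) c₀ W₂) (x : TSite 3 (periodsT3 F K)) (μ : Fin 3)
      (Nω Hω Mu Mw G₂ δ Θ α j : ℝ), 0 ≤ Nω → 0 ≤ Hω → 0 ≤ Mu → 0 ≤ Mw → 0 ≤ G₂ → 0 ≤ δ → 0 ≤ Θ → 0 ≤ α → 0 ≤ j →
      covLapSite F n K c₀ V u = ω →
      (∀ y, tdist (periodsT3 F K) x y ≤ 4 * (F.L : ℝ) ^ (K - n) + 2 → ‖WL2.equiv ℂ (fun _ : TSite 3 (periodsT3 F K) => c₀) W₂ ω y‖ ≤ Nω) →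
      (∀ y y' : TSite 3 (periodsT3 F K), tdist (periodsT3 F K) x y ≤ 4 * (F.L : ℝ) ^ (K - n) + 1 → tdist (periodsT3 F K) x y' ≤ 4 * (F.L : ℝ) ^ (K - n) + 1 →
        ‖WL2.equiv ℂ (fun _ : TSite 3 (periodsT3 F K) => c₀) W₂ ω y' - WL2.equiv ℂ (fun _ : TSite 3 (periodsT3 F K) => c₀) W₂ ω y‖
          ≤ Hω * (tdist (periodsT3 F K) y y' / ((F.L : ℝ) ^ (K - n))) ^ ((1 : ℝ) / 2)) →
      (∀ y, tdist (periodsT3 F K) x y ≤ 4 * (F.L : ℝ) ^ (K - n) + 1 → ‖WL2.equiv ℂ (fun _ : TSite 3 (periodsT3 F K) => c₀) W₂ u y‖ ≤ Mu) →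
      (∀ (y : TSite 3 (periodsT3 F K)) (κ : Fin 3), tdist (periodsT3 F K) x y ≤ 4 * (F.L : ℝ) ^ (K - n) + 2 →
        ‖WL2.equiv ℂ (fun _ : Bond 3 (periodsT3 F K) => c₀) W₂ (DL2 F n K c₀ V u) (y, κ)‖ ≤ Mw) →
      (∀ (z : TSite 3 (periodsT3 F K)) (ν : Fin 3), tdist (periodsT3 F K) x z ≤ 12 * (F.L : ℝ) ^ (K - n) + 3 →
        (F.L : ℝ) ^ (K - n) * ‖WL2.equiv ℂ (fun _ : Bond 3 (periodsT3 F K) => c₀) W₂ (DL2 F n K c₀ V u) (shift ν z, μ) -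
            WL2.equiv ℂ (fun _ : Bond 3 (periodsT3 F K) => c₀) W₂ (DL2 F n K c₀ V u) (z, μ)‖ ≤ G₂) →
      (∀ (κ ν : Fin 3) (y : TSite 3 (periodsT3 F K)),
        ‖((plaqU (fun μ => shiftEquiv (Pd := periodsT3 F K) μ) (fun μ y => bgOfCfg F K V (y, μ)) κ ν y : (Matrix (Fin 2) (Fin 2) ℂ)ˣ) : Matrix (Fin 2) (Fin 2) ℂ) - 1‖
          ≤ α * eta F n K ^ 2) →
      (∀ y, tdist (periodsT3 F K) x y ≤ 4 * (F.L : ℝ) ^ (K - n) → ‖J (fun μ => shiftEquiv (Pd := periodsT3 F K) μ) (fun μ y => bgOfCfg F K V (y, μ)) (eta F n K) μ y‖ ≤ j) →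
      (∀ (y : TSite 3 (periodsT3 F K)) (κ : Fin 3), tdist (periodsT3 F K) x y ≤ 4 * (F.L : ℝ) ^ (K - n) + 1 →
        ‖((bgOfCfg F K V (y, κ) : (Matrix (Fin 2) (Fin 2) ℂ)ˣ) : Matrix (Fin 2) (Fin 2) ℂ) - 1‖ ≤ δ) →
      (∀ (y y' : TSite 3 (periodsT3 F K)) (κ : Fin 3), tdist (periodsT3 F K) x y ≤ 4 * (F.L : ℝ) ^ (K - n) → tdist (periodsT3 F K) x y' ≤ 4 * (F.L : ℝ) ^ (K - n) →
        ‖((bgOfCfg F K V (y', κ) : (Matrix (Fin 2) (Fin 2) ℂ)ˣ) : Matrix (Fin 2) (Fin 2) ℂ) - ((bgOfCfg F K V (y, κ) : (Matrix (Fin 2) (Fin 2) ℂ)ˣ) : Matrix (Fin 2) (Fin 2) ℂ)‖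
          ≤ Θ * (tdist (periodsT3 F K) y y' / ((F.L : ℝ) ^ (K - n))) ^ ((1 : ℝ) / 2)) →
      ∀ ν : Fin 3, (F.L : ℝ) ^ (K - n) *
          ‖WL2.equiv ℂ (fun _ : Bond 3 (periodsT3 F K) => c₀) W₂ (DL2 F n K c₀ V u) (shift ν x, μ) -
            WL2.equiv ℂ (fun _ : Bond 3 (periodsT3 F K) => c₀) W₂ (DL2 F n K c₀ V u) (x, μ)‖
        ≤ CH * (Mw + ((2 * Real.sqrt 2 * Θ * Nω + Hω) + 2 * Real.sqrt 2 * (((F.L : ℝ) ^ (K - n) * Θ) * Mw + ((F.L : ℝ) ^ (K - n) * δ) * (3 * Real.sqrt 10 * G₂)))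
          + (6 * Real.sqrt 2 * ((F.L : ℝ) ^ (K - n) * δ) * (Nω + G₂ + 2 * Real.sqrt 2 * ((F.L : ℝ) ^ (K - n) * δ) * Mw) + Mw
            + Real.sqrt 2 * ((2 * j + 24 * α ^ 2 * eta F n K) * Mu + 12 * α * Mw))) := by
  obtain ⟨Cg, hCg0, hG13⟩ := exists_curved_localGradient
  refine ⟨Cg, hCg0, ?_⟩
  intro F n K c₀ _ V u ω x μ Nω Hω Mu Mw G₂ δ Θ α j hNω0 hHω0 hMu0 hMw0 hG₂0 hδ0 hΘ0 hα0 hj0 hEq hNω hHω hMu hMw hG₂ hpl hJ hδ hΘ ν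
  have hη : 0 < eta F n K := eta_pos F n K
  have hP1 : ∀ i, 1 ≤ periodsT3 F K i := one_le_periodsT3 F K
  -- the slice `w_μ`, its datum `A_ω`, and the commutator, as the objects of (G1-3a)
  set w : SiteL2K ℂ 3 (periodsT3 F K) c₀ W₂ :=
    (WL2.equiv ℂ (fun _ : TSite 3 (periodsT3 F K) => c₀) W₂).symm fun y => WL2.equiv ℂ (fun _ : Bond 3 (periodsT3 F K) => c₀) W₂ (DL2 F n K c₀ V u) (y, μ) with hwdef
  set A : BondL2K ℂ 3 (periodsT3 F K) c₀ W₂ := (WL2.equiv ℂ (fun _ : Bond 3 (periodsT3 F K) => c₀) W₂).symm fun b =>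
        if b.2 = μ then -(adBg F K V (b.1, μ) (WL2.equiv ℂ (fun _ : TSite 3 (periodsT3 F K) => c₀) W₂ ω (shift μ b.1))) else 0 with hAdef
  set C : SiteL2K ℂ 3 (periodsT3 F K) c₀ W₂ := (WL2.equiv ℂ (fun _ : TSite 3 (periodsT3 F K) => c₀) W₂).symm fun x =>
          (((eta F n K : ℝ) : ℂ))⁻¹ • ((((eta F n K : ℝ) : ℂ))⁻¹ • ((((eta F n K : ℝ) : ℂ))⁻¹ • ∑ κ,
            ((adBg F K V (x, μ) (adBg F K V (shift μ x, κ) (WL2.equiv ℂ (fun _ : TSite 3 (periodsT3 F K) => c₀) W₂ u (shift κ (shift μ x)))) -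
                adBg F K V (x, κ) (adBg F K V (shift κ x, μ) (WL2.equiv ℂ (fun _ : TSite 3 (periodsT3 F K) => c₀) W₂ u (shift μ (shift κ x))))) +
             (adBg F K V (x, μ) (adBgInv F K V (unshift κ (shift μ x), κ) (WL2.equiv ℂ (fun _ : TSite 3 (periodsT3 F K) => c₀) W₂ u (unshift κ (shift μ x)))) -
                adBgInv F K V (unshift κ x, κ) (adBg F K V (unshift κ x, μ) (WL2.equiv ℂ (fun _ : TSite 3 (periodsT3 F K) => c₀) W₂ u (shift μ (unshift κ x)))))))) with hCdef
  have hw : ∀ y, WL2.equiv ℂ (fun _ : TSite 3 (periodsT3 F K) => c₀) W₂ w y = WL2.equiv ℂ (fun _ : Bond 3 (periodsT3 F K) => c₀) W₂ (DL2 F n K c₀ V u) (y, μ) := fun y => by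
    rw [hwdef, Equiv.apply_symm_apply]
  have hAap : ∀ b, WL2.equiv ℂ (fun _ : Bond 3 (periodsT3 F K) => c₀) W₂ A b =
      (if b.2 = μ then -(adBg F K V (b.1, μ) (WL2.equiv ℂ (fun _ : TSite 3 (periodsT3 F K) => c₀) W₂ ω (shift μ b.1))) else 0 : W₂) := fun b => by
    rw [hAdef, Equiv.apply_symm_apply]
  -- the equation
  have h : covLapSite F n K c₀ V w + (-C) = DstarL2 F n K c₀ V A := slice_equation F n K c₀ V u ω hEq μ
  -- the rows of the data `A_ω`
  have hMf : ∀ (y : TSite 3 (periodsT3 F K)) (κ : Fin 3), tdist (periodsT3 F K) x y ≤ 4 * (F.L : ℝ) ^ (K - n) + 1 →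
      ‖WL2.equiv ℂ (fun _ : Bond 3 (periodsT3 F K) => c₀) W₂ A (y, κ)‖ ≤ Nω := by
    intro y κ hy
    rw [hAap]
    refine (norm_Aω_le F K V _ μ (y, κ)).trans (hNω _ ?_)
    calc (tdist (periodsT3 F K) x (shift μ y) : ℝ) ≤ tdist (periodsT3 F K) x y + tdist (periodsT3 F K) y (shift μ y) := tdist_triangle hP1 _ _ _
      _ ≤ (4 * (F.L : ℝ) ^ (K - n) + 1) + 1 := add_le_add hy (B9SectCLatticeCarrier.tdist_shift_le hP1 μ y)
      _ = _ := by ring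
  have hHf : ∀ (y y' : TSite 3 (periodsT3 F K)) (κ : Fin 3), tdist (periodsT3 F K) x y ≤ 4 * (F.L : ℝ) ^ (K - n) → tdist (periodsT3 F K) x y' ≤ 4 * (F.L : ℝ) ^ (K - n) →
      ‖WL2.equiv ℂ (fun _ : Bond 3 (periodsT3 F K) => c₀) W₂ A (y', κ) - WL2.equiv ℂ (fun _ : Bond 3 (periodsT3 F K) => c₀) W₂ A (y, κ)‖
        ≤ (2 * Real.sqrt 2 * Θ * Nω + Hω) * (tdist (periodsT3 F K) y y' / ((F.L : ℝ) ^ (K - n))) ^ ((1 : ℝ) / 2) := by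
    intro y y' κ hy hy'
    rw [hAap, hAap]
    refine (norm_Aω_sub_le F K V _ μ κ y y').trans ?_
    have hρ0 : 0 ≤ (tdist (periodsT3 F K) y y' / ((F.L : ℝ) ^ (K - n))) ^ ((1 : ℝ) / 2) :=
      Real.rpow_nonneg (div_nonneg (tdist_nonneg _ _ _) (by positivity)) _
    have h1 := hΘ y y' μ hy hy'
    have hsy' : tdist (periodsT3 F K) x (shift μ y') ≤ 4 * (F.L : ℝ) ^ (K - n) + 2 := by
      calc (tdist (periodsT3 F K) x (shift μ y') : ℝ) ≤ tdist (periodsT3 F K) x y' + tdist (periodsT3 F K) y' (shift μ y') := tdist_triangle hP1 _ _ _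
        _ ≤ 4 * (F.L : ℝ) ^ (K - n) + 1 := add_le_add hy' (B9SectCLatticeCarrier.tdist_shift_le hP1 μ y')
        _ ≤ _ := by linarith
    have h2 := hNω _ hsy'
    have hsy1 : tdist (periodsT3 F K) x (shift μ y) ≤ 4 * (F.L : ℝ) ^ (K - n) + 1 := by
      calc (tdist (periodsT3 F K) x (shift μ y) : ℝ) ≤ tdist (periodsT3 F K) x y + tdist (periodsT3 F K) y (shift μ y) := tdist_triangle hP1 _ _ _
        _ ≤ _ := add_le_add hy (B9SectCLatticeCarrier.tdist_shift_le hP1 μ y)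
    have hsy1' : tdist (periodsT3 F K) x (shift μ y') ≤ 4 * (F.L : ℝ) ^ (K - n) + 1 := by
      calc (tdist (periodsT3 F K) x (shift μ y') : ℝ) ≤ tdist (periodsT3 F K) x y' + tdist (periodsT3 F K) y' (shift μ y') := tdist_triangle hP1 _ _ _
        _ ≤ _ := add_le_add hy' (B9SectCLatticeCarrier.tdist_shift_le hP1 μ y')
    have h3 := hHω (shift μ y) (shift μ y') hsy1 hsy1'
    rw [tdist_shift_shift hP1] at h3
    calc 2 * Real.sqrt 2 * ‖((bgOfCfg F K V (y', μ) : (Matrix (Fin 2) (Fin 2) ℂ)ˣ) : Matrix (Fin 2) (Fin 2) ℂ) - ((bgOfCfg F K V (y, μ) : (Matrix (Fin 2) (Fin 2) ℂ)ˣ) : Matrix (Fin 2) (Fin 2) ℂ)‖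
            * ‖WL2.equiv ℂ (fun _ : TSite 3 (periodsT3 F K) => c₀) W₂ ω (shift μ y')‖ +
          ‖WL2.equiv ℂ (fun _ : TSite 3 (periodsT3 F K) => c₀) W₂ ω (shift μ y') - WL2.equiv ℂ (fun _ : TSite 3 (periodsT3 F K) => c₀) W₂ ω (shift μ y)‖
        ≤ 2 * Real.sqrt 2 * (Θ * (tdist (periodsT3 F K) y y' / ((F.L : ℝ) ^ (K - n))) ^ ((1 : ℝ) / 2)) * Nω
          + Hω * (tdist (periodsT3 F K) y y' / ((F.L : ℝ) ^ (K - n))) ^ ((1 : ℝ) / 2) := by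
          gcongr
      _ = _ := by ring
  -- the row of the remainder `q := −Comm_μ(u)`
  have hMq : ∀ y, tdist (periodsT3 F K) x y ≤ 4 * (F.L : ℝ) ^ (K - n) →
      ‖WL2.equiv ℂ (fun _ : TSite 3 (periodsT3 F K) => c₀) W₂ (-C) y‖ ≤ Real.sqrt 2 * ((2 * j + 24 * α ^ 2 * eta F n K) * Mu + 12 * α * Mw) := by
    intro y hy
    have hneg : WL2.equiv ℂ (fun _ : TSite 3 (periodsT3 F K) => c₀) W₂ (-C) y = -(WL2.equiv ℂ (fun _ : TSite 3 (periodsT3 F K) => c₀) W₂ C y) := rfl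
    rw [hneg, norm_neg, hCdef, Equiv.apply_symm_apply]
    refine (norm_comm_le F n K c₀ V hα0 hpl u μ y).trans ?_
    have hsy : tdist (periodsT3 F K) x (shift μ y) ≤ 4 * (F.L : ℝ) ^ (K - n) + 1 := by
      calc (tdist (periodsT3 F K) x (shift μ y) : ℝ) ≤ tdist (periodsT3 F K) x y + tdist (periodsT3 F K) y (shift μ y) := tdist_triangle hP1 _ _ _
        _ ≤ _ := add_le_add hy (B9SectCLatticeCarrier.tdist_shift_le hP1 μ y)
    have hu1 := hMu _ hsy
    have hJ1 := hJ y hy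
    have hw1 : ∀ κ, ‖WL2.equiv ℂ (fun _ : Bond 3 (periodsT3 F K) => c₀) W₂ (DL2 F n K c₀ V u) (shift μ y, κ)‖ ≤ Mw := fun κ => hMw _ κ (hsy.trans (by linarith))
    have hw2 : ∀ κ, ‖WL2.equiv ℂ (fun _ : Bond 3 (periodsT3 F K) => c₀) W₂ (DL2 F n K c₀ V u) (unshift κ (shift μ y), κ)‖ ≤ Mw := by
      intro κ
      refine hMw _ κ ?_
      calc (tdist (periodsT3 F K) x (unshift κ (shift μ y)) : ℝ) ≤ tdist (periodsT3 F K) x (shift μ y) + tdist (periodsT3 F K) (shift μ y) (unshift κ (shift μ y)) :=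
            tdist_triangle hP1 _ _ _
        _ ≤ (4 * (F.L : ℝ) ^ (K - n) + 1) + 1 := add_le_add hsy (B9SectCLatticeCarrier.tdist_unshift_le hP1 κ _)
        _ = _ := by ring
    have hsum : ∑ κ : Fin 3, (‖WL2.equiv ℂ (fun _ : Bond 3 (periodsT3 F K) => c₀) W₂ (DL2 F n K c₀ V u) (shift μ y, κ)‖ +
          ‖WL2.equiv ℂ (fun _ : Bond 3 (periodsT3 F K) => c₀) W₂ (DL2 F n K c₀ V u) (unshift κ (shift μ y), κ)‖) ≤ 3 * (Mw + Mw) := by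
      calc _ ≤ ∑ _κ : Fin 3, (Mw + Mw) := Finset.sum_le_sum fun κ _ => add_le_add (hw1 κ) (hw2 κ)
        _ = 3 * (Mw + Mw) := by rw [Finset.sum_const, Finset.card_univ, Fintype.card_fin, nsmul_eq_mul]; push_cast; ring
    have hJ2 : 0 ≤ 2 * ‖J (fun μ => shiftEquiv (Pd := periodsT3 F K) μ) (fun μ y => bgOfCfg F K V (y, μ)) (eta F n K) μ y‖ + 8 * (3 : ℕ) * α ^ 2 * eta F n K := by positivity
    calc 1 * Real.sqrt 2 * ((2 * ‖J (fun μ => shiftEquiv (Pd := periodsT3 F K) μ) (fun μ y => bgOfCfg F K V (y, μ)) (eta F n K) μ y‖ + 8 * (3 : ℕ) * α ^ 2 * eta F n K) *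
            ‖WL2.equiv ℂ (fun _ : TSite 3 (periodsT3 F K) => c₀) W₂ u (shift μ y)‖ +
          2 * α * ∑ κ, (‖WL2.equiv ℂ (fun _ : Bond 3 (periodsT3 F K) => c₀) W₂ (DL2 F n K c₀ V u) (shift μ y, κ)‖ +
            ‖WL2.equiv ℂ (fun _ : Bond 3 (periodsT3 F K) => c₀) W₂ (DL2 F n K c₀ V u) (unshift κ (shift μ y), κ)‖))
        ≤ 1 * Real.sqrt 2 * ((2 * j + 8 * (3 : ℕ) * α ^ 2 * eta F n K) * Mu + 2 * α * (3 * (Mw + Mw))) := by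
          gcongr
      _ = Real.sqrt 2 * ((2 * j + 24 * α ^ 2 * eta F n K) * Mu + 12 * α * Mw) := by push_cast; ring
  -- the local rows of `w_μ` itself
  have hMwu : ∀ y, tdist (periodsT3 F K) x y ≤ 4 * (F.L : ℝ) ^ (K - n) + 1 → ‖WL2.equiv ℂ (fun _ : TSite 3 (periodsT3 F K) => c₀) W₂ w y‖ ≤ Mw := fun y hy => by
    rw [hw]; exact hMw y μ (hy.trans (by linarith))
  have hGw : ∀ (z : TSite 3 (periodsT3 F K)) (ν : Fin 3), tdist (periodsT3 F K) x z ≤ 12 * (F.L : ℝ) ^ (K - n) + 3 →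
      (F.L : ℝ) ^ (K - n) * ‖WL2.equiv ℂ (fun _ : TSite 3 (periodsT3 F K) => c₀) W₂ w (shift ν z) - WL2.equiv ℂ (fun _ : TSite 3 (periodsT3 F K) => c₀) W₂ w z‖ ≤ G₂ := by
    intro z ν hz; rw [hw, hw]; exact hG₂ z ν hz
  have hMC0 : 0 ≤ Real.sqrt 2 * ((2 * j + 24 * α ^ 2 * eta F n K) * Mu + 12 * α * Mw) := by positivity
  have hHA0 : 0 ≤ 2 * Real.sqrt 2 * Θ * Nω + Hω := by positivity
  have hmain := hG13 F n K c₀ V w (-C) A x Mw G₂ Nω (2 * Real.sqrt 2 * Θ * Nω + Hω) (Real.sqrt 2 * ((2 * j + 24 * α ^ 2 * eta F n K) * Mu + 12 * α * Mw)) δ Θ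
    hMw0 hG₂0 hNω0 hHA0 hMC0 hδ0 hΘ0 h hMwu hGw hMf hHf hMq hδ hΘ ν
  rw [hw, hw] at hmain
  exact hmain

end Summit.QuantumFields.YangMills.Theorems.Prop7CurvedMemberLocalHessian

end
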